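import Summits.BirchSwinnertonDyer.BirchSwinnertonDyer.Theorems.SmallImageMuTransferMuTransferX9LocalQTermAdapter
import Summits.BirchSwinnertonDyer.BirchSwinnertonDyer.Theorems.SmallImageMuTransferMuTransferX9StepFourFinal
import HarnessLib

/-!
# K6 crux `MuTransferX9` (stmt-BirchSwinnertonDyer-19276): STEP 4 + Lemma 1 (iii) JOINED — the G3/G4
# meeting point of `stub_stepsTwoFourOdd` WITHOUT the `hQ` hypothesis

Cell `bsd-smallim`, seat `bsd-smallim-koly` gen 8 (route `SmallImageMuTransfer`, rung K6, leaf
`Rank1Residual.BSDpOnClassX9`). HONEST FRAMING: TOOL theorem; no definition, no named fact, no `sorry`;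
nothing is asserted about any curve and nothing is booked. Serves the registered stub `stub_stepsTwoFourOdd`
of crux 19276 (skeleton v6 a90a661b046bb403) and credits nothing toward its closure (`--supports … --as
helper`). PARTITION (D-0054): X9 (A4) × p ∈ {5, 7} · X10b∧¬Surj (A5) × p = 3 (odd `p`, any number field)
— helper; closes NONE.

## Content
* **`convCoeff_eq_zero_of_transverse_of_unramified`** — x10's `StepFour.convCoeff_eq_zero_of_qTermIdentity`
  (p454438: Poitou–Tate for the family `inv` + unramified orthogonality off `S ∪ {q}` + `T^ε loc_v [Ψc] = 0`
  on `S` ⟹ every member of the coefficient family of the `q`-term vanishes ⟹ with `hQ` the convolution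
  coefficients `C_i(c(res τ_q), Ψc(res Fr_q))`, `i + ε < J`, vanish) with its hypothesis `hQ` DISCHARGED by
  koly's `exists_unit_qTermIdentity` (p457415, Lemma 1 (iii) up to the unit `u_q(T)`): for a global cocycle
  `c` of `𝒯_J` unramified off `S ∪ {q}` whose localisation at `q` is TRANSVERSE (the Kolyvagin class `κ_q` of
  G3) and a global cocycle `Ψc` of `𝒯′_J` unramified off `S` with `T^ε loc_v[Ψc] = 0` on `S` (the Selmer-side
  class of G1), at an `E`-split arithmetic Frobenius `Fr` of `K_q` of depth `m` and a tame generator `t₀`: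
  **`C_i(c(res t₀), Ψc(res Fr)) = 0` for every `i + ε < J`**.  The remaining inputs are all hypotheses of the
  two cited theorems (odd `p`, perfect `e`, `ι : μ_p ↪ ℤ/p` with `ι e(v₀,w₀) = 1`, `inv` with `IsPerfect` and
  `SumLocalTermEqZero` = the content of the fact `poitouTate_sum_localTatePairing_eq_zero`, `p ∣ N(q) − 1`,
  `χ̄_ℓ` onto on inertia).

References: HOME/koly/MU-TRANSFER-PROOF.md §5 STEP 4 and §2 Lemma 1 (iii); B. Mazur, K. Rubin, Mem. AMS 799
(2004) Prop. 1.3.2, §4.4 [MazurRubin2004]; J. S. Milne, *Arithmetic Duality Theorems* (2006) I Thm. 4.10(b)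
[MilneADT2006].
-/

set_option linter.dupNamespace false
set_option autoImplicit false

noncomputable section

open scoped Classical ContRepresentation

universe u

namespace Summit.BirchSwinnertonDyer.BirchSwinnertonDyer.Rank1Residual.LocalSplitPrime

open CategoryTheory ContinuousCohomology Function Field ValuativeRel NumberField IsDedekindDomain Finset
open Literature.NumberTheory.GaloisRepresentations
open Literature.NumberTheory.GaloisRepresentations.IsNonarchimedeanLocalField
open _root_.TopRep
open Literature.NumberTheory.GaloisCohomology
open Literature.NumberTheory.EllipticCurves
open Summit.BirchSwinnertonDyer.Rank1Residual.GaloisImage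

section Joined

variable {K : Type u} [Field K] [NumberField K] {p : ℕ} [Fact p.Prime]
  {M M' : Type u} [AddCommGroup M] [TopologicalSpace M] [DiscreteTopology M] [Finite M]
  [AddCommGroup M'] [TopologicalSpace M'] [DiscreteTopology M'] [Finite M']
  (ρ : DiscreteGaloisModule K M) (ρ' : DiscreteGaloisModule K M')
  (hM : ∀ x : M, p • x = 0) (hM' : ∀ x : M', p • x = 0) (κ : ZpExtension K p) (J : ℕ)
  (q : HeightOneSpectrum (𝓞 K)) [Fact (Ideal.absNorm q.asIdeal).Prime]
  [NeZero ((Ideal.absNorm q.asIdeal : ℕ) : q.adicCompletion K)]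
  [LocallyCompactSpace (absoluteGaloisGroup K)]
  [LocallyCompactSpace (absoluteGaloisGroup (Place.Completion (Sum.inr q : Place K)))]

/-- **STEP 4 of Theorem A at the auxiliary prime, `hQ`-free**: x10's `StepFour.convCoeff_eq_zero_of_qTermIdentity`
with its `hQ` hypothesis supplied by koly's `exists_unit_qTermIdentity`.  Conclusion: the convolution
coefficients `C_i(c(res t₀), Ψc(res Fr))` of the values of the Kolyvagin-class cocycle `c` (at the tame
generator) and of the Selmer-side cocycle `Ψc` (at the `E`-split Frobenius) vanish for all `i + ε < J`.
[cite: MazurRubin2004, Prop. 1.3.2 and §4.4] [cite: MilneADT2006, Ch. I, Thm. 4.10(b)] -/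
theorem convCoeff_eq_zero_of_transverse_of_unramified (hp : p ≠ 2)
    {e : M →+ M' →+ DiscreteGaloisModule.MuCarrier K p}
    (he : ∀ (g : absoluteGaloisGroup K) (a : M) (b : M'),
      e (ρ g a) (ρ' g b) = DiscreteGaloisModule.mu K p g (e a b))
    (hnd : ∀ b : M', (∀ a : M, e a b = 0) → b = 0)
    (hsurj : ∀ χ : M →+ DiscreteGaloisModule.MuCarrier K p, ∃ b : M', ∀ a, e a b = χ a)
    (ι : DiscreteGaloisModule.MuCarrier K p →+ ZMod p) (hι : Function.Injective ι)
    {v₀ : M} {w₀ : M'} (h1 : ι (e v₀ w₀) = 1)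
    {inv : LocalInvariants K p} (hperf : inv.IsPerfect) (hPT : inv.SumLocalTermEqZero)
    (S : Set (HeightOneSpectrum (𝓞 K))) (hq : q ∉ S)
    (hSp : ∀ v ∉ S, ((p : ℕ) : 𝓞 K) ∉ v.asIdeal) (hur : ∀ v ∉ S, GaloisRep.IsUnramifiedAt v ρ)
    (hunr' : GaloisRep.IsUnramifiedAt q ρ') (hpl : p ∣ Ideal.absNorm q.asIdeal - 1)
    (hχI : ∀ u : (ZMod (Ideal.absNorm q.asIdeal))ˣ, ∃ t ∈ absInertia (q.adicCompletion K),
      modPCyclotomicCharacterZMod (q.adicCompletion K) (Ideal.absNorm q.asIdeal) t = u)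
    {Fr : absoluteGaloisGroup (q.adicCompletion K)} (hFr : IsAbsArithFrob Fr)
    (hsplit : ρ (absGaloisRestrict K (q.adicCompletion K) Fr) = 1)
    (hsplit' : ρ' (absGaloisRestrict K (q.adicCompletion K) Fr) = 1) {m : ℕ} (hm : m + 1 ≤ J)
    (hFrm : absGaloisRestrict K (q.adicCompletion K) Fr ∈ κ.layerSubgroup m)
    (hFrm' : absGaloisRestrict K (q.adicCompletion K) Fr ∉ κ.layerSubgroup (m + 1))
    {t₀ : absoluteGaloisGroup (q.adicCompletion K)} (ht₀ : t₀ ∈ absInertia (q.adicCompletion K))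
    (hgen : ∀ u : (ZMod (Ideal.absNorm q.asIdeal))ˣ,
      u ∈ Subgroup.zpowers (modPCyclotomicCharacterZMod (q.adicCompletion K) (Ideal.absNorm q.asIdeal) t₀))
    (c : contOneCocycles (κ.twistModP ρ hM J).toTopRep)
    (hx : ∀ v ∉ S, v ≠ q → galoisCohomology.localization (κ.twistModP ρ hM J) (Sum.inr v) 1
        (oneCocycleClass (κ.twistModP ρ hM J).toTopRep c) ∈
      DiscreteGaloisModule.unramifiedSubgroup (GaloisRep.toLocal v (κ.twistModP ρ hM J)) 1)
    (hcq : galoisCohomology.localization (κ.twistModP ρ hM J) (Sum.inr q) 1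
        (oneCocycleClass (κ.twistModP ρ hM J).toTopRep c) ∈
      DiscreteGaloisModule.transverseSubgroup (GaloisRep.toLocal q (κ.twistModP ρ hM J))
        (CyclotomicField (Ideal.absNorm q.asIdeal) (q.adicCompletion K)))
    (Ψc : contOneCocycles (κ.invTwist.twistModP ρ' hM' J).toTopRep)
    (hΨ : ∀ v ∉ S, galoisCohomology.localization (κ.invTwist.twistModP ρ' hM' J) (Sum.inr v) 1
        (oneCocycleClass (κ.invTwist.twistModP ρ' hM' J).toTopRep Ψc) ∈
      DiscreteGaloisModule.unramifiedSubgroup (GaloisRep.toLocal v (κ.invTwist.twistModP ρ' hM' J)) 1)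
    (ε : ℕ)
    (hΨS : ∀ v ∈ S, galoisCohomology.localization (κ.invTwist.twistModP ρ' hM' J) (Sum.inr v) 1
      ((κ.invTwist.shiftH1 ρ' hM' J)^[ε] (oneCocycleClass (κ.invTwist.twistModP ρ' hM' J).toTopRep Ψc)) = 0) :
    ∀ i, i + ε < J → convCoeff e J i (c.1 (absGaloisRestrict K (q.adicCompletion K) t₀))
      (Ψc.1 (absGaloisRestrict K (q.adicCompletion K) Fr)) = 0 := by
  obtain ⟨u, hu0, hu⟩ := exists_unit_qTermIdentity ρ ρ' hM hM' κ J q hp he hnd hsurj ι hι h1 (hur q hq) hunr'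
    (hSp q hq) hpl hχI hFr hsplit hsplit' hm hFrm hFrm' ht₀ hgen inv hperf
  exact StepFour.convCoeff_eq_zero_of_qTermIdentity κ ρ ρ' hM hM' J he hp hPT S q hq hSp hur c hx Ψc hΨ ε hΨS
    t₀ Fr (AddMonoidHom.id (ZMod p)) ι hι u hu0 fun k hk => hu c hcq Ψc (hΨ q hq) ε k hk

end Joined

end Summit.BirchSwinnertonDyer.BirchSwinnertonDyer.Rank1Residual.LocalSplitPrime

end
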